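import Summits.BirchSwinnertonDyer.BirchSwinnertonDyer.Theorems.PrintCFramBottomClassIndexLawFiveLeCutFormPeriodicCut
import Literature.NumberTheory.ModularForms.ModPModularFormsQExpansion
import HarnessLib

/-!
# Crux `PrintCFram.BottomClassIndexLawFiveLe` (stmt-BirchSwinnertonDyer-20372), line `eisenstein-resource-bdp-line`
# (registry v24): NF-C IN MOD-`p` CURRENCY — the twist / cut of a mod-`p` modular form of level `Γ₁(N)` is a mod-`p`
# modular form of level `Γ₁(N Q²)`
# (cell `bsd-print-cfram`, width seat `bsd-line-cfram-p1-w3` g12; THEOREMS ONLY, `--supports` 20372; BSD is not proved by any of this)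

HONEST FRAMING. Nothing here is a statement about BSD; no registered stub is closed. The GLUE of `stub_cutForm` (LEAD g13's
(G4)) works inside w6 g6's Katz family `ModP.modPForms p N k ⊆ 𝔽_p⟦q⟧` (reductions of rational `p`-integral `q`-expansions of
`ModularForm (Gamma1 N) k`, `Literature.NumberTheory.ModularForms.ModPModularFormsQExpansion`). This file restates the kernel
theorem NF-C (`Literature.NumberTheory.ModularForms.PeriodicTwist`, p689460) in that currency, so that the cut is applied
AFTER reduction mod `p` and no second descent to characteristic `0` is needed:

* `twist_mem_modPForms` — for a `Q`-periodic INTEGER-valued multiplier `c` and `g ∈ modPForms p N k`: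
  `Σ (c n mod p)·gₙ qⁿ ∈ modPForms p (N Q²) k` (lift `g` to a form `f` with rational `p`-integral expansion `x`, twist `f` by
  `n ↦ (c n : ℂ)` — a form on `Γ₁(N Q²)` by NF-C —, new witness `n ↦ c n · x n`; rationality and `p`-integrality are kept
  because `c` is `ℤ`-valued);
* `cut_mem_modPForms` / `cuspCut_mem_modPForms` — the cuts along the two registered index sets (CUT(m,r,e) of `stub_cutForm`,
  period `8m²r^(e+1)`; the (3,0)-cut of `stub_cuspCutForm`, period `24m²`; periodicity = p690820 §1).

No definitions, no named facts, no `sorry`. beyond-print theorem: NO (Shimura 1971 Prop. 3.64 bookkeeping mod `p`).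
-/

set_option autoImplicit false
-- summit-side namespace `Summit.BirchSwinnertonDyer.BirchSwinnertonDyer.…` (single-conjunct summit, D-0017 layout)
set_option linter.dupNamespace false

open scoped Classical NumberTheorySymbols
open PowerSeries UpperHalfPlane CongruenceSubgroup

namespace Summit.BirchSwinnertonDyer.BirchSwinnertonDyer.Theorems.PrintCFram.CutForm

open Literature.NumberTheory.ModularForms

/-! ## §1 Twist of a mod-`p` form by a periodic integer multiplier -/

/-- **NF-C in mod-`p` currency.** For a prime `p`, levels `N, Q ≥ 1`, a `Q`-periodic integer-valued multiplier `c : ℕ → ℤ`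
and `g = Σ gₙ qⁿ ∈ M̃_k(Γ₁(N))` (w6 g6's `ModP.modPForms p N k`: the reduction of a rational `p`-integral `q`-expansion of a
complex modular form of weight `k` on `Γ₁(N)`), the twisted series `Σ (c n) gₙ qⁿ` lies in `M̃_k(Γ₁(N Q²))`. Proof: lift,
twist in characteristic `0` by `PeriodicTwist.exists_modularForm_gamma1_qExpansion_coeff_eq_mul_of_periodic` (Shimura 1971
Prop. 3.64 with a periodic multiplier), reduce. Nothing about BSD. -/
theorem twist_mem_modPForms (p : ℕ) [Fact p.Prime] {N k Q : ℕ} [NeZero N] [NeZero Q] {c : ℕ → ℤ}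
    (hc : Function.Periodic c Q) {g : PowerSeries (ZMod p)} (hg : g ∈ ModP.modPForms p N k) :
    (PowerSeries.mk fun n ↦ (c n : ZMod p) * coeff n g) ∈ ModP.modPForms p (N * Q ^ 2) k := by
  obtain ⟨f, x, hf, hgx⟩ := hg
  have hcC : Function.Periodic (fun n ↦ (c n : ℂ)) Q := fun n ↦ by simp only [hc n]
  obtain ⟨f', hf'⟩ := PeriodicTwist.exists_modularForm_gamma1_qExpansion_coeff_eq_mul_of_periodic f hcC
  refine ⟨f', fun n ↦ (c n : ℤ_[p]) * x n, fun n ↦ ?_, fun n ↦ ?_⟩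
  · obtain ⟨a, ha, hxa⟩ := hf n
    refine ⟨c n * a, ?_, ?_⟩
    · rw [hf' n, ha]
      push_cast
      rfl
    · push_cast
      rw [hxa]
  · rw [coeff_mk, hgx n, map_mul, map_intCast]

/-! ## §2 The two registered cuts -/

/-- **The `m`-cut of a mod-`p` form is a mod-`p` form of level `Γ₁(N Q₀²)`, `Q₀ = 8m²r^(e+1)`**: for `g ∈ M̃_k(Γ₁(N))`,
`Σ_{a ∈ CUT(m,r,e)} g_a q^a ∈ M̃_k(Γ₁(N·(8m²r^(e+1))²))`, where CUT(m,r,e) is the support clause of the `hcut` binder of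
`ThetaCycle.atP_six_of_cutForm` VERBATIM (periodic by `cutIndex_add_iff`, p690820). This is the `G`-side use of NF-C in the
glue of `stub_cutForm`. Nothing about BSD; no registered stub is closed. -/
theorem cut_mem_modPForms (p : ℕ) [Fact p.Prime] {N k : ℕ} [NeZero N] (m r e : ℕ) (hm : 0 < m) (hr : 0 < r)
    {g : PowerSeries (ZMod p)} (hg : g ∈ ModP.modPForms p N k) :
    (PowerSeries.mk fun a ↦
        if (m ∣ a ∧ a / m % 4 = 3 ∧ (∀ q : ℕ, q.Prime → q ∣ m → q ≠ 2 → jacobiSym (-((a / m : ℕ) : ℤ)) q = 1) ∧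
            (2 ∣ m → a / m % 8 = 7) ∧ r ^ e ∣ a / m ∧ ¬ r ^ (e + 1) ∣ a / m)
        then coeff a g else 0) ∈ ModP.modPForms p (N * (8 * m ^ 2 * r ^ (e + 1)) ^ 2) k := by
  haveI : NeZero (8 * m ^ 2 * r ^ (e + 1)) := ⟨by positivity⟩
  let c : ℕ → ℤ := fun a ↦
    if (m ∣ a ∧ a / m % 4 = 3 ∧ (∀ q : ℕ, q.Prime → q ∣ m → q ≠ 2 → jacobiSym (-((a / m : ℕ) : ℤ)) q = 1) ∧
        (2 ∣ m → a / m % 8 = 7) ∧ r ^ e ∣ a / m ∧ ¬ r ^ (e + 1) ∣ a / m) then 1 else 0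
  have hc : Function.Periodic c (8 * m ^ 2 * r ^ (e + 1)) := fun a ↦ by
    have h := cutIndex_add_iff m r e a 1 hm
    rw [mul_one] at h
    simp only [c, h]
  have key := twist_mem_modPForms p hc hg
  convert key using 2
  funext a
  simp only [c]
  split_ifs <;> simp

/-- **The (3,0)-cut of a mod-`p` form is a mod-`p` form of level `Γ₁(N Q₁²)`, `Q₁ = 24m²`**: for `g ∈ M̃_k(Γ₁(N))`,
`Σ_{a ∈ CUT'(m)} g_a q^a ∈ M̃_k(Γ₁(N·(24m²)²))`, where CUT'(m) is the support clause of the `hcut` binder of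
`CuspSeed.cuspSeed_six_of_cutForm` VERBATIM (periodic by `cuspCutIndex_add_iff`, p690820) — the `G`-side use of NF-C in the
glue of `stub_cuspCutForm` (its cusp conjunct is NOT touched). Nothing about BSD; no registered stub is closed. -/
theorem cuspCut_mem_modPForms (p : ℕ) [Fact p.Prime] {N k : ℕ} [NeZero N] (m : ℕ) (hm : 0 < m)
    {g : PowerSeries (ZMod p)} (hg : g ∈ ModP.modPForms p N k) :
    (PowerSeries.mk fun a ↦
        if (m ∣ a ∧ a / m % 4 = 3 ∧ (∀ q : ℕ, q.Prime → q ∣ m → q ≠ 2 → jacobiSym (-((a / m : ℕ) : ℤ)) q = 1) ∧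
            (2 ∣ m → a / m % 8 = 7) ∧ ¬ 3 ∣ a / m)
        then coeff a g else 0) ∈ ModP.modPForms p (N * (24 * m ^ 2) ^ 2) k := by
  haveI : NeZero (24 * m ^ 2) := ⟨by positivity⟩
  let c : ℕ → ℤ := fun a ↦
    if (m ∣ a ∧ a / m % 4 = 3 ∧ (∀ q : ℕ, q.Prime → q ∣ m → q ≠ 2 → jacobiSym (-((a / m : ℕ) : ℤ)) q = 1) ∧
        (2 ∣ m → a / m % 8 = 7) ∧ ¬ 3 ∣ a / m) then 1 else 0
  have hc : Function.Periodic c (24 * m ^ 2) := fun a ↦ by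
    have h := cuspCutIndex_add_iff m a 1 hm
    rw [mul_one] at h
    simp only [c, h]
  have key := twist_mem_modPForms p hc hg
  convert key using 2
  funext a
  simp only [c]
  split_ifs <;> simp

end Summit.BirchSwinnertonDyer.BirchSwinnertonDyer.Theorems.PrintCFram.CutForm
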